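import Literature.AlgebraicGeometry.HodgeTheory.WeilTypeCMFieldHodgeLieSUOfBlocks
import Literature.AlgebraicGeometry.HodgeTheory.CMHodgeGroupTwoMixedPlacesKWeilNoDiv
import Literature.AlgebraicGeometry.HodgeTheory.CMFieldOneBalancedPlaceHodgeLie
import HarnessLib

/-!
# `Lie Hg(A) ⊗ ℂ ⊇ (𝔲_E ∩ 𝔰𝔲_K) ⊗ ℂ` for an abelian variety of WEIL TYPE `(3, d)` with `End⁰(A) ⊗ ℚ = ℚ[φ_E]` COMMUTATIVE of
# dimension `4` (a quartic CM field — TABLE X ROW 11 — OR `K × K` — TABLE X ROW 19 `Y₃ × Y₃′`), CM type = the `K`-fibre,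
# multiplicity `3`, both places mixed: R11-6b WITHOUT SIMPLICITY (Moonen–Zarhin 1998 §4; 1999 (2.3), (5.11); Ribet 1983)

Family `hodge`, layer `Literature/AlgebraicGeometry/HodgeTheory` (cell `pub-hodgeav-hg6`, req-37 (A) Q2b, TABLE X ROWS 11 ∕ 19; eng-4 g9,
brick T3b (B); lead g4 GO 2026-08-29T07:47:19Z). UNCONDITIONAL; theorems only, no definition, no named fact, no `sorry`. HONEST
FRAMING of that cell: HC ∕ HC_AV (stmt-1333) ∕ HC_CM (stmt-3052) ∕ H2 NOT proved — a statement about `Lie Hg(A)`.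

WHAT THIS FILE DOES. It GENERALISES R11-6b `WeilTypeQuarticCMFieldHodgeLieSU`
(`IsWeilType.mem_hodgeLieC_of_commute_of_skew_of_trace_of_cmField_twoMixed`) by deleting its simplicity hypothesis, which served
only to make `End_Hdg(H¹A) = ℚ[φ_E^*]` a division algebra for R11-5; the division-free Hodge-structure theorem
`CMThetaKWeil.mem_hodgeLieC_of_commute_of_skew_of_trace_twoMixed_noDiv` (`CMHodgeGroupTwoMixedPlacesKWeilNoDiv`) makes it idle.
The proof is R11-6b's, transplanted (AV → Hodge dictionary: `End_Hdg = ℚ[φ_E^*]` from `dim_ℚ End⁰(A) = 2|ι|` and the `2|ι|`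
distinct eigenvalues, multiplicities, `htop`, `φ^*` is `ψ`-skew, the `W_K`-trace is the sum of the two block traces
`IsWeilType.hSU_of_blockTraceLie`) — a documented generalisation, not a restatement.

* **`IsWeilType.mem_hodgeLieC_of_commute_of_skew_of_trace_of_cmAlgebra_twoMixed`** — DATA: `(A, φ)` of Weil type `(3, d)`,
  `φ_E ∈ End(A)` with `dim_ℚ End⁰(A) = 2|ι|`, a CM type `μ` of `φ_E^*` with TWO places `k₁ ≠ k₂` covering `ι`, pair multiplicity
  `3`, BOTH places MIXED, `K`-signature `n_{μ k₁} + n_{μ k₂} = 3`, and `μ` THE `K`-FIBRE (`W_{μ k} ⊆ W_K`, `W_{μ̄ k} ⊆ W̄_K`).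
  CONCLUSION = the displayed Lie hypothesis `hSU` of the socket
  `IsWeilType.mem_hodgeGroupOne_of_mem_unitaryCentralizerGroup_of_cmField_of_hodgeLieC` (p698115, itself simplicity-free),
  VERBATIM. MEMBERS: row 11 (`A` simple, `E` biquadratic) and row 19 (`A ∼ Y₃ × Y₃′`, `Y ≄ Y′` simple type-IV threefolds with
  `End⁰ = K`, diagonal `K` of Weil type `(3,3)`, signatures `(2,1)` ∕ `(1,2)`: `End⁰(A) = K × K`, the blocks `W_K(Y)`, `W_K(Y′)`).

## References
* [MoonenZarhin1998WeilClasses] B. Moonen, Yu. Zarhin, J. reine angew. Math. 496 (1998), §4 Remark (1).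
* [MoonenZarhin1999LowDim] B. Moonen, Yu. Zarhin, Math. Ann. 315 (1999), §2 (2.3), (1.9), §5 (5.11) Case 1.
* [Ribet1983] K. A. Ribet, Amer. J. Math. 105 (1983), Thm. 0, §3.
* [vanGeemen1994HodgeAV] B. van Geemen, LNM 1594 (1994), 4.9 and 6.9.
* [MumfordAV1970] D. Mumford, Abelian varieties (1970), §19 Cor. 2 of Thm. 1 (p. 174).
-/

noncomputable section

open scoped TensorProduct Matrix
open CategoryTheory Module

namespace Literature.AlgebraicGeometry.HodgeTheory

open Literature.AlgebraicTopology.SingularHomology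
open Literature.AlgebraicGeometry.Motives (IsSmoothProjective AbelianVariety bettiCohomology HodgeTensorFacts hodgeTensorFacts_holds)
open Literature.AlgebraicGeometry.Motives.HodgeStructure
open Literature.AlgebraicGeometry.ComplexMultiplication (bettiRep bettiRep_of)

variable {A : AbelianVariety ℂ} {φ : A ⟶ A} {d : ℕ} {ι : Type} [Fintype ι] [DecidableEq ι]

/-- The two elements of `Fin 2`. [folklore] -/
private theorem fin2_cases₈ (r : Fin 2) : r = 0 ∨ r = 1 := by
  fin_cases r <;> simp


/-- **`Lie Hg(H¹A) ⊗ ℂ ⊇ (𝔲_E ∩ 𝔰𝔲_K) ⊗ ℂ` FOR EVERY ROW-11 AND ROW-19 MEMBER — NO SIMPLICITY** (generalises R11-6b's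
`IsWeilType.mem_hodgeLieC_of_commute_of_skew_of_trace_of_cmField_twoMixed` by deleting the simplicity binder; proof transplanted,
the Hodge-structure theorem replaced by its division-free form `…_twoMixed_noDiv`): `(A, φ)` of Weil type `(3, d)`, `φ_E ∈ End(A)`
with `dim_ℚ End⁰(A) = 2|ι|` (`End⁰(A) ⊗ ℚ = ℚ[φ_E]`: a quartic CM field OR `K × K`), CM type `μ` = the `K`-fibre with two places,
pair multiplicity `3`, both places mixed, `K`-signature `3` along `μ`.
[cite: MoonenZarhin1998WeilClasses, §4 Remark (1)] [cite: MoonenZarhin1999LowDim, §2 (2.3)] [cite: Ribet1983, Thm. 0]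
[cite: vanGeemen1994HodgeAV, 4.9] [cite: MumfordAV1970, §19 Cor. 2 of Thm. 1 (p. 174)] -/
theorem IsWeilType.mem_hodgeLieC_of_commute_of_skew_of_trace_of_cmAlgebra_twoMixed [HodgeTensorFacts.{0, 0}]
    (hW : IsWeilType A φ 3 d) (φE : A ⟶ A) (hE : Module.finrank ℚ A.endAlgebra = 2 * Fintype.card ι)
    (μ : ι → ℂ) (hinj : Function.Injective μ) (hdist : ∀ k k', μ k' ≠ starRingEnd ℂ (μ k))
    (hmult : ∀ k, eigenMultiplicity A φE (μ k) + eigenMultiplicity A φE (starRingEnd ℂ (μ k)) = 3)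
    (hmixed : ∀ k, eigenMultiplicity A φE (μ k) ≠ 0 ∧ eigenMultiplicity A φE (starRingEnd ℂ (μ k)) ≠ 0)
    (k₁ k₂ : ι) (hk : k₁ ≠ k₂) (hι : ∀ k, k = k₁ ∨ k = k₂)
    (hKW : eigenMultiplicity A φE (μ k₁) + eigenMultiplicity A φE (μ k₂) = 3)
    (hKE : ∀ k, Module.End.eigenspace (((bettiCohomology.map φE.hom.hom.hom 1).hom).baseChange ℂ) (μ k) ≤
      Module.End.eigenspace (((bettiCohomology.map φ.hom.hom.hom 1).hom).baseChange ℂ) (Complex.I * (Real.sqrt d : ℂ)))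
    (hKE' : ∀ k, Module.End.eigenspace (((bettiCohomology.map φE.hom.hom.hom 1).hom).baseChange ℂ) (starRingEnd ℂ (μ k)) ≤
      Module.End.eigenspace (((bettiCohomology.map φ.hom.hom.hom 1).hom).baseChange ℂ) (-(Complex.I * (Real.sqrt d : ℂ))))
    (ψ : (BettiUniverse.hodge exists_isReal_hodgeModel_holds (AbelianVariety.isSmoothProjective_holds (A := A)) 1).Polarization) :
    ∀ (Y : Module.End ℂ (ℂ ⊗[ℚ] bettiCohomology A.X 1))
      (hYφ : Y * ((bettiCohomology.map φ.hom.hom.hom 1).hom).baseChange ℂ =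
        ((bettiCohomology.map φ.hom.hom.hom 1).hom).baseChange ℂ * Y),
      Y * ((bettiCohomology.map φE.hom.hom.hom 1).hom).baseChange ℂ =
        ((bettiCohomology.map φE.hom.hom.hom 1).hom).baseChange ℂ * Y →
      (∀ x y, ψ.form.baseChange ℂ (Y x) y + ψ.form.baseChange ℂ x (Y y) = 0) →
      LinearMap.trace ℂ _ (Y.restrict fun x (hx : x ∈ Module.End.eigenspace
          (((bettiCohomology.map φ.hom.hom.hom 1).hom).baseChange ℂ) (Complex.I * (Real.sqrt d : ℂ))) =>
        UnitaryTheta.apply_mem_eigenspace_of_commute hYφ hx) = 0 →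
      Y ∈ (BettiUniverse.hodge exists_isReal_hodgeModel_holds (AbelianVariety.isSmoothProjective_holds (A := A)) 1).hodgeLieC := by
  classical
  have hHD : exists_isReal_hodgeModel := exists_isReal_hodgeModel_holds
  have hI : hodgePQ_independent_of_hodgeModel := hodgePQ_independent_of_hodgeModel_holds
  haveI : Module.Finite ℚ (bettiCohomology A.X 1) := finite_bettiCohomology_one A
  have hX : IsSmoothProjective A.dim A.X := AbelianVariety.isSmoothProjective_holds
  have heff := BettiUniverse.hodge_isEffective hHD hX 1
  -- `|ι| = 2`, `dim A = 6 = |ι| · 3`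
  have hcard2 : Fintype.card ι = 2 := by
    have huniv : (Finset.univ : Finset ι) = {k₁, k₂} := by
      ext k
      simp only [Finset.mem_univ, Finset.mem_insert, Finset.mem_singleton, true_iff]
      exact hι k
    rw [← Finset.card_univ, huniv, Finset.card_insert_of_notMem (by rw [Finset.mem_singleton]; exact hk),
      Finset.card_singleton]
  have hdim : A.dim = Fintype.card ι * 3 := by rw [hW.dim_eq, hcard2]
  -- reduce `hSU` to the two-block statement
  refine hW.hSU_of_blockTraceLie φE hE μ hinj hdist (by norm_num : 0 < 3) hmult hdim hKE hKE' ψ k₁ k₂ hk hι ?_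
  intro Y hYφE hYskew hYtr
  -- the rational data `φ_E^*_ℚ` (the CM generator) and `φ^*_ℚ` (the `K`-operator)
  set φQ : Module.End ℚ (bettiCohomology A.X 1) := (bettiCohomology.map φE.hom.hom.hom 1).hom with hφQ
  set φK : Module.End ℚ (bettiCohomology A.X 1) := (bettiCohomology.map φ.hom.hom.hom 1).hom with hφK
  set μK : ℂ := Complex.I * (Real.sqrt d : ℂ) with hμKdef
  have hμK0 : μK ≠ 0 := mul_ne_zero Complex.I_ne_zero
    (Complex.ofReal_ne_zero.2 (Real.sqrt_ne_zero'.2 (Nat.cast_pos.2 hW.d_pos)))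
  have hφE' : φQ ∈ (BettiUniverse.hodge hHD (AbelianVariety.isSmoothProjective_holds (A := A)) 1).endAlg := by
    have h := unop_bettiRep_mem_endAlg hHD hI (AbelianVariety.endAlgebra.of A φE)
    rwa [bettiRep_of, MulOpposite.unop_op] at h
  have hφKE : φK ∈ (BettiUniverse.hodge hHD (AbelianVariety.isSmoothProjective_holds (A := A)) 1).endAlg := by
    have h := unop_bettiRep_mem_endAlg hHD hI (AbelianVariety.endAlgebra.of A φ)
    rwa [bettiRep_of, MulOpposite.unop_op] at h
  have hVC : Module.finrank ℂ (ℂ ⊗[ℚ] bettiCohomology A.X 1) = Fintype.card (ι × Fin 2) * 3 := by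
    rw [Module.finrank_baseChange, finrank_bettiCohomology_one A, hdim, Fintype.card_prod, Fintype.card_fin]; ring
  -- the `2|ι|` eigenvalues, pairwise distinct
  set ev : ι × Fin 2 → ℂ := fun kt => if kt.2 = 0 then μ kt.1 else starRingEnd ℂ (μ kt.1) with hevdef
  have hev0 : ∀ k, ev (k, 0) = μ k := fun k => by simp [hevdef]
  have hev1 : ∀ k, ev (k, 1) = starRingEnd ℂ (μ k) := fun k => by simp [hevdef]
  have hev : Function.Injective ev := by
    rintro ⟨k, t⟩ ⟨k', t'⟩ h
    rcases fin2_cases₈ t with rfl | rfl <;> rcases fin2_cases₈ t' with rfl | rfl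
    · rw [hev0, hev0] at h; rw [hinj h]
    · rw [hev0, hev1] at h; exact absurd h (hdist k' k)
    · rw [hev1, hev0] at h; exact absurd h.symm (hdist k k')
    · rw [hev1, hev1] at h; rw [hinj ((starRingEnd ℂ).injective h)]
  -- the multiplicity dictionary
  have hgr := fun cc => CMTheta.finrank_eigenspace_eq_add
    (BettiUniverse.hodge hHD (AbelianVariety.isSmoothProjective_holds (A := A)) 1) Nat.cast_one heff hφE' cc
  have h10 : ∀ cc, Module.finrank ℂ ↥(Module.End.eigenspace (φQ.baseChange ℂ) cc ⊓
      (BettiUniverse.hodge hHD (AbelianVariety.isSmoothProjective_holds (A := A)) 1).piece 1 0) =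
        eigenMultiplicity A φE cc := fun cc => by
    rw [hφQ, finrank_eigenspace_inf_piece_oneZero_eq_eigenMultiplicity hHD hI φE cc]
  have h01 : ∀ cc, Module.finrank ℂ ↥(Module.End.eigenspace (φQ.baseChange ℂ) cc ⊓
      (BettiUniverse.hodge hHD (AbelianVariety.isSmoothProjective_holds (A := A)) 1).piece 0 1) =
        eigenMultiplicity A φE (starRingEnd ℂ cc) := fun cc => by
    rw [hφQ, finrank_eigenspace_inf_piece_zeroOne_eq_eigenMultiplicity_conj hHD hI φE cc]
  have hfin : ∀ kt, Module.finrank ℂ ↥(Module.End.eigenspace (φQ.baseChange ℂ) (ev kt)) = 3 := by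
    rintro ⟨k, t⟩
    rw [hgr, h10, h01]
    rcases fin2_cases₈ t with rfl | rfl
    · rw [hev0]; exact hmult k
    · rw [hev1, starRingEnd_self_apply, add_comm]; exact hmult k
  have hWne : ∀ kt, Module.End.eigenspace (φQ.baseChange ℂ) (ev kt) ≠ ⊥ := by
    intro kt hkt
    have h := hfin kt
    rw [hkt, finrank_bot] at h
    omega
  -- `End_Hdg = ℚ[φ_E^*]`
  have hcard : Fintype.card (ι × Fin 2) = 2 * Fintype.card ι := by rw [Fintype.card_prod, Fintype.card_fin, mul_comm]
  set e : ι × Fin 2 ≃ Fin (2 * Fintype.card ι) := Fintype.equivFinOfCardEq hcard with hedef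
  have hEφ := exists_eq_sum_smul_pow_bettiMapHom_fin hHD hI φE hE (ev ∘ e.symm) (hev.comp e.symm.injective)
    fun j => hWne (e.symm j)
  -- `hrank`, `htop`
  have hrank : ∀ k, Module.finrank ℂ ↥(Module.End.eigenspace (φQ.baseChange ℂ) (μ k) ⊓
      (BettiUniverse.hodge hHD (AbelianVariety.isSmoothProjective_holds (A := A)) 1).piece 1 0) +
      Module.finrank ℂ ↥(Module.End.eigenspace (φQ.baseChange ℂ) (μ k) ⊓
      (BettiUniverse.hodge hHD (AbelianVariety.isSmoothProjective_holds (A := A)) 1).piece 0 1) = 3 := fun k => by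
    rw [h10, h01]; exact hmult k
  have htop : (⨆ kt : ι × Fin 2, Module.End.eigenspace (φQ.baseChange ℂ) (ev kt)) = ⊤ := by
    have hind : iSupIndep fun kt => Module.End.eigenspace (φQ.baseChange ℂ) (ev kt) :=
      (Module.End.eigenspaces_iSupIndep (φQ.baseChange ℂ)).comp hev
    apply Submodule.eq_top_of_finrank_eq
    have h := Motives.finrank_biSup_eq_sum_of_iSupIndep hind Finset.univ
    have hs : (⨆ kt ∈ (Finset.univ : Finset (ι × Fin 2)), Module.End.eigenspace (φQ.baseChange ℂ) (ev kt)) =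
        ⨆ kt, Module.End.eigenspace (φQ.baseChange ℂ) (ev kt) := by simp
    rw [hs] at h
    rw [h, hVC, Finset.sum_congr rfl fun kt _ => hfin kt, Finset.sum_const, Finset.card_univ, smul_eq_mul]
  -- the pattern, in the Hodge dictionary
  have hmixed' : ∀ k, Module.finrank ℂ ↥(Module.End.eigenspace (φQ.baseChange ℂ) (μ k) ⊓
      (BettiUniverse.hodge hHD (AbelianVariety.isSmoothProjective_holds (A := A)) 1).piece 1 0) ≠ 0 ∧
      Module.finrank ℂ ↥(Module.End.eigenspace (φQ.baseChange ℂ) (μ k) ⊓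
      (BettiUniverse.hodge hHD (AbelianVariety.isSmoothProjective_holds (A := A)) 1).piece 0 1) ≠ 0 := fun k => by
    rw [h10, h01]; exact hmixed k
  have hbal : ((Module.finrank ℂ ↥(Module.End.eigenspace (φQ.baseChange ℂ) (μ k₁) ⊓
      (BettiUniverse.hodge hHD (AbelianVariety.isSmoothProjective_holds (A := A)) 1).piece 1 0) : ℤ) -
      Module.finrank ℂ ↥(Module.End.eigenspace (φQ.baseChange ℂ) (μ k₁) ⊓
      (BettiUniverse.hodge hHD (AbelianVariety.isSmoothProjective_holds (A := A)) 1).piece 0 1)) +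
      ((Module.finrank ℂ ↥(Module.End.eigenspace (φQ.baseChange ℂ) (μ k₂) ⊓
      (BettiUniverse.hodge hHD (AbelianVariety.isSmoothProjective_holds (A := A)) 1).piece 1 0) : ℤ) -
      Module.finrank ℂ ↥(Module.End.eigenspace (φQ.baseChange ℂ) (μ k₂) ⊓
      (BettiUniverse.hodge hHD (AbelianVariety.isSmoothProjective_holds (A := A)) 1).piece 0 1)) = 0 := by
    rw [h10, h01, h10, h01]
    have h1 := hmult k₁; have h2 := hmult k₂
    omega
  -- the `K`-datum on the blocks: `φ^*_ℂ = ±i√d` on `W_{μ k}` ∕ `W_{μ̄ k}`, hence `φ^*` is `ψ`-skew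
  have hKEv : ∀ k, ∀ w ∈ Module.End.eigenspace (φQ.baseChange ℂ) (μ k), φK.baseChange ℂ w = μK • w := fun k w hw =>
    Module.End.mem_eigenspace_iff.1 (hKE k hw)
  have hKE'v : ∀ k, ∀ w ∈ Module.End.eigenspace (φQ.baseChange ℂ) (starRingEnd ℂ (μ k)), φK.baseChange ℂ w = -(μK • w) :=
    fun k w hw => by rw [← neg_smul]; exact Module.End.mem_eigenspace_iff.1 (hKE' k hw)
  have hKskew : ∀ v w, ψ.form (φK v) w + ψ.form v (φK w) = 0 :=
    CMThetaKWeil.skew_of_apply_eq_neg (BettiUniverse.hodge hHD (AbelianVariety.isSmoothProjective_holds (A := A)) 1) Nat.cast_one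
      heff ψ hφE' hEφ μ hinj hdist htop (fun _ => μK) hKEv hKE'v
  -- the Hodge-structure theorem
  exact CMThetaKWeil.mem_hodgeLieC_of_commute_of_skew_of_trace_twoMixed_noDiv
    (BettiUniverse.hodge hHD (AbelianVariety.isSmoothProjective_holds (A := A)) 1) Nat.cast_one heff ψ hφE' hEφ μ hinj
    hdist hrank htop hφKE hKskew hμK0 hKEv hmixed' k₁ k₂ hk hι hbal hYφE hYskew hYtr

end Literature.AlgebraicGeometry.HodgeTheory

end
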